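import Mathlib.Analysis.SpecialFunctions.Trigonometric.Series
import Literature.NumberTheory.LFunctions.KatkovaPF44Proofs
import Literature.NumberTheory.LFunctions.JensenPolyaProofs
import Literature.Analysis.TotalPositivity.PolyaFrequencyEntireZeros
import Literature.Analysis.TotalPositivity.ASWERepresentation
import HarnessLib

/-!
# Katkova's Theorem 3 (`e^{nz} ξ₁`, `cosh(n√z) ξ₁ ∈ PF_m` for `n ≥ n₀(m)`) — named fact; the two
# RH-equivalences that follow it — proved

Trunk T-NT-LFUNC (Literature/NumberTheory/LFunctions). Completes the vendoring of
[Katkova2006] (O. M. Katkova, *Multiple positivity and the Riemann zeta-function*, CMFT 7 (2007)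
13–31 = arXiv:math/0505174) begun in `XiMultiplePositivity.lean` (Thm. C, Thm. 1, Thm. 2 as the
named facts `katkova_rh_iff_pf`, `katkova_pf44`, `katkova_apf`, all three DISCHARGED in
`XiMultiplePositivityProofs.lean` / `KatkovaPF44Proofs.lean`; Schoenberg's Theorem B is
`Literature.Analysis.TotalPositivity.schoenberg_sector_pf_holds`). What was missing is

* **Theorem 3** [Katkova2006, Thm. 3, arXiv p. 6]: "For every `m ∈ ℕ` there exists `n₀ ∈ ℕ` such
  that for all `n ≥ n₀` the following inclusions hold: (i) `e^{nz} ξ₁(z) ∈ PF_m`;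
  (ii) `cosh(n√z) ξ₁(z) ∈ PF_m`." — the NAMED FACT `katkova_exp_cosh_pf` below (nothing asserted;
  users take `(h : katkova_exp_cosh_pf)`). Its printed proof (§§2–4, arXiv pp. 7–22: Lemma 1 =
  Pólya's composition formula, the saddle-point Proposition 2 uniformly in `0 < ε < 1` for
  `f²_ε(z) = e^z f₁(εz)`, `ε = 1/n`, and `f³_ε(z) = cosh(√z) f₁(εz)`, `ε = 1/n²`, and the Fekete-type
  Lemma 3 of [17]) is not in the tree.
* the two **RH-equivalences** stated right after it [Katkova2006, arXiv pp. 6–7]: "multiplication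
  by the function `e^{nz}` does not change zero set of `ξ₁(z)` and multiplication by the function
  `cosh(n√z)` adds only negative zeros … Hence the Riemann Hypothesis is equivalent to each of the
  statements: `∃ n ∈ ℕ ∀ m ∈ ℕ : e^{nz} ξ₁(z) ∈ PF_m` or `∃ n ∈ ℕ ∀ m ∈ ℕ : cosh(n√z) ξ₁(z) ∈ PF_m`."
  — PROVED here (`riemannHypothesis_iff_exists_forall_pf_exp_mul`,
  `riemannHypothesis_iff_exists_forall_pf_cosh_mul`, and for each fixed `n` the sharper
  `isPolyaFrequencySeq_conv_exp_xi_iff`, `isPolyaFrequencySeq_conv_cosh_xi_iff`), from the tree's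
  `RH ⇔ ξ₁ ∈ PF_∞` (`riemannHypothesis_iff_isPolyaFrequencySeq_xi`), closure of PF under
  convolution, and the Aissen–Schoenberg–Whitney zero theorem for ENTIRE PF generating functions
  (`Literature.Analysis.TotalPositivity.IsPolyaFrequencySeq.zero_of_entire`, which needs no order
  hypothesis, so the order-`1` factor `e^{nz}` is harmless).

**Dictionary** (as in `XiMultiplePositivity.lean`). Katkova's `ξ₁(z) = ξ(√z + 1/2) = Σ b_k z^k`
is the tree's `xiSq` with `b_k = xiSqCoeff k = γ(k)/(8·k!)` (`γ = xiTaylorCoeff`, GORZ); the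
tree's facts use `a_k := γ(k)/k! = 8 b_k`. "`f ∈ PF_m`" for a generating function `f = Σ c_k z^k`
means that `(c_k)` is `m`-times positive [Katkova2006, §1 Def. 2: "The class of `m`-times positive
sequences and the class of corresponding generating functions are both denoted by `PF_m`"], i.e.
`IsMultiplyPositiveSeq m c` (`MultiplyPositive.lean`). The coefficient sequence of a product is
the convolution `conv` (`MultiplyPositiveProofs.lean`) of the coefficient sequences, and
`e^{nz} = Σ n^k z^k/k!`, `cosh(n√z) = Σ n^{2k} z^k/(2k)!`; so "`e^{nz} ξ₁ ∈ PF_m`" is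
`IsMultiplyPositiveSeq m (conv (n^k/k!)ₖ (b_k)ₖ)`, and since `conv e (8b) = 8 conv e b` and `PF_m`
is invariant under multiplication by a positive constant (`IsMultiplyPositiveSeq.smul`), it is
equivalently `IsMultiplyPositiveSeq m (conv (n^k/k!)ₖ (a_k)ₖ)` — the form used below. The
dictionary is PROVED, not just asserted: `hasSum_conv_exp_xi` / `hasSum_conv_cosh_xi` identify
`Σ (conv …)_k z^k` with `8 e^{nz} ξ₁(z)` / `8 cosh(n w) ξ₁(z)` (`w² = z`), and
`taylorCoeff_exp_mul_xiSq` gives `(e^{nz}ξ₁)⁽ᵏ⁾(0)/k! = 8⁻¹ (conv …)_k`.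

## Main statements

* `katkova_exp_cosh_pf` — NAMED FACT, Theorem 3 (i) ∧ (ii) as printed.
* `katkova_exp_cosh_pf_of_le` — for `m ≤ 49` both inclusions hold for EVERY `n` (so `n₀ = 0`),
  unconditionally: `ξ₁ ∈ PF₄₉` (`isMultiplyPositiveSeq_xi_fortyNine`), `e^{nz}, cosh(n√z) ∈ PF_∞`
  and `PF_m ⋆ PF_m ⊆ PF_m`; `katkova_exp_cosh_pf_of_riemannHypothesisUpTo` (all `m + 1 ≤ πT`
  given RH to height `T`); `katkova_exp_cosh_pf_of_riemannHypothesis`.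
* `isPolyaFrequencySeq_conv_exp_xi_iff`, `isPolyaFrequencySeq_conv_cosh_xi_iff` — for every real
  `c ≥ 0`: `e^{cz} ξ₁ ∈ PF_∞ ↔ RH`, `cosh(c√z) ξ₁ ∈ PF_∞ ↔ RH`;
  `riemannHypothesis_iff_exists_forall_pf_exp_mul`, `riemannHypothesis_iff_exists_forall_pf_cosh_mul`
  — Katkova's two displayed equivalences.

## References

* O. M. Katkova, *Multiple positivity and the Riemann zeta-function*, Comput. Methods Funct.
  Theory 7 (2007) 13–31; arXiv:math/0505174, §1 Def. 2, Thm. 3 and the remark following it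
  (pp. 6–7), §2 (15)–(18), Lemma 3. [Katkova2006]
* M. Aissen, A. Edrei, I. J. Schoenberg, A. Whitney, Proc. Nat. Acad. Sci. USA 37 (1951)
  303–307, Thm. 5. [AissenEdreiSchoenbergWhitney1951]
-/

noncomputable section

open Complex Filter
open scoped Nat Topology

namespace Literature.NumberTheory.LFunctions

open Literature.Analysis.TotalPositivity

/-! ### The named fact -/

/-- NAMED FACT (**Katkova 2006, Theorem 3**): "For every `m ∈ ℕ` there exists `n₀ ∈ ℕ` such that
for all `n ≥ n₀` the following inclusions hold: (i) `e^{nz} ξ₁(z) ∈ PF_m`; (ii)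
`cosh(n√z) ξ₁(z) ∈ PF_m`." Here `ξ₁(z) = ξ(1/2 + √z) = Σ b_k z^k`, `f ∈ PF_m` means that the
Maclaurin coefficient sequence of `f` is `m`-times positive [Katkova2006, §1 Def. 2], the
coefficient sequence of `e^{nz} ξ₁(z)` is the convolution of `(n^k/k!)ₖ` with `(b_k)ₖ` and that of
`cosh(n√z) ξ₁(z) = (Σ n^{2k} z^k/(2k)!) ξ₁(z)` is the convolution of `(n^{2k}/(2k)!)ₖ` with
`(b_k)ₖ` (`hasSum_conv_exp_xi`, `hasSum_conv_cosh_xi`, `taylorCoeff_exp_mul_xiSq`). As in the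
tree's other Katkova facts the sequence is written in the normalisation `a_k = γ(k)/k! = 8 b_k`
(`γ = xiTaylorCoeff`), which changes every convolution by the factor `8 > 0` and no sign of any
minor (`IsMultiplyPositiveSeq.smul`). For `m ≤ 49` the statement is a theorem of the tree with
`n₀ = 0` (`katkova_exp_cosh_pf_of_le`); RH gives it for all `m, n`
(`katkova_exp_cosh_pf_of_riemannHypothesis`); conversely `∃ n ∀ m` (i) (or (ii)) implies RH
(`riemannHypothesis_iff_exists_forall_pf_exp_mul`). Users take `(h : katkova_exp_cosh_pf)`.
[cite: Katkova2006, Thm. 3] -/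
def katkova_exp_cosh_pf : Prop :=
  ∀ m : ℕ, ∃ n₀ : ℕ, ∀ n : ℕ, n₀ ≤ n →
    IsMultiplyPositiveSeq m
        (conv (fun k => (n : ℝ) ^ k / (k ! : ℝ)) (fun k => xiTaylorCoeff k / (k ! : ℝ))) ∧
      IsMultiplyPositiveSeq m
        (conv (fun k => (n : ℝ) ^ (2 * k) / ((2 * k) ! : ℝ)) (fun k => xiTaylorCoeff k / (k ! : ℝ)))

/-! ### The coefficient sequences of `e^{cz}` and `cosh(c√z)` are Pólya frequency sequences -/

/-- `(c^{2k}/(2k)!)ₖ`, the coefficient sequence of `cosh(c√z)`, is the even-indexed subsequence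
of `(c^k/k!)ₖ`, hence a Pólya frequency sequence for `c ≥ 0` [Katkova2006, §2, arXiv p. 10:
"Since the matrix (8) of coefficients of `cosh(√z)` is the submatrix of the matrix (8) of
coefficients of `e^z` the function `cosh(√z) ∈ SPF_∞`"] (`isPolyaFrequencySeq_exp`,
`IsPolyaFrequencySeq.subseq_even`). [cite: Katkova2006, §2 (proof of Thm. 3″)] -/
theorem isPolyaFrequencySeq_cosh_sqrt {c : ℝ} (hc : 0 ≤ c) :
    IsPolyaFrequencySeq fun k => c ^ (2 * k) / ((2 * k) ! : ℝ) :=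
  (isPolyaFrequencySeq_exp hc).subseq_even

/-- `e^{cz} f ∈ PF_m` whenever `f ∈ PF_m` and `c ≥ 0` (convolution with the PF sequence
`(c^k/k!)`; Cauchy–Binet). [Katkova2006, §1–2] [folklore] -/
theorem _root_.Literature.Analysis.TotalPositivity.IsMultiplyPositiveSeq.conv_exp {m : ℕ} {a : ℕ → ℝ} (ha : IsMultiplyPositiveSeq m a)
    {c : ℝ} (hc : 0 ≤ c) :
    IsMultiplyPositiveSeq m (conv (fun k => c ^ k / (k ! : ℝ)) a) :=
  ((isPolyaFrequencySeq_exp hc).isMultiplyPositiveSeq m).conv ha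

/-- `cosh(c√z) f ∈ PF_m` whenever `f ∈ PF_m` and `c ≥ 0`. [Katkova2006, §2] [folklore] -/
theorem _root_.Literature.Analysis.TotalPositivity.IsMultiplyPositiveSeq.conv_cosh_sqrt {m : ℕ} {a : ℕ → ℝ} (ha : IsMultiplyPositiveSeq m a)
    {c : ℝ} (hc : 0 ≤ c) :
    IsMultiplyPositiveSeq m (conv (fun k => c ^ (2 * k) / ((2 * k) ! : ℝ)) a) :=
  ((isPolyaFrequencySeq_cosh_sqrt hc).isMultiplyPositiveSeq m).conv ha

/-! ### Theorem 3 for `m ≤ 49` unconditionally, for `m + 1 ≤ πT` from RH to height `T`, and from RH -/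

/-- **Theorem 3 (i) ∧ (ii) for every `n`, given `ξ₁ ∈ PF_m`.** [cite: Katkova2006, Thm. 3] -/
theorem katkova_exp_cosh_pf_of_isMultiplyPositiveSeq {m : ℕ}
    (h : IsMultiplyPositiveSeq m (fun k => xiTaylorCoeff k / (k ! : ℝ))) (n : ℕ) :
    IsMultiplyPositiveSeq m
        (conv (fun k => (n : ℝ) ^ k / (k ! : ℝ)) (fun k => xiTaylorCoeff k / (k ! : ℝ))) ∧
      IsMultiplyPositiveSeq m
        (conv (fun k => (n : ℝ) ^ (2 * k) / ((2 * k) ! : ℝ))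
          (fun k => xiTaylorCoeff k / (k ! : ℝ))) :=
  ⟨h.conv_exp n.cast_nonneg, h.conv_cosh_sqrt n.cast_nonneg⟩

/-- **Katkova's Theorem 3 for `m ≤ 49`, unconditionally and with `n₀ = 0`**: `ξ₁ ∈ PF₄₉`
(`isMultiplyPositiveSeq_xi_fortyNine`, from RH up to height `16` via Schoenberg's Theorem B) and
`PF_m` is closed under convolution with the PF sequences of `e^{nz}`, `cosh(n√z)`.
[cite: Katkova2006, Thm. 3] -/
theorem katkova_exp_cosh_pf_of_le {m : ℕ} (hm : m ≤ 49) (n : ℕ) :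
    IsMultiplyPositiveSeq m
        (conv (fun k => (n : ℝ) ^ k / (k ! : ℝ)) (fun k => xiTaylorCoeff k / (k ! : ℝ))) ∧
      IsMultiplyPositiveSeq m
        (conv (fun k => (n : ℝ) ^ (2 * k) / ((2 * k) ! : ℝ))
          (fun k => xiTaylorCoeff k / (k ! : ℝ))) :=
  katkova_exp_cosh_pf_of_isMultiplyPositiveSeq (isMultiplyPositiveSeq_xi_fortyNine.mono hm) n

/-- **Theorem 3 for all `m + 1 ≤ πT` and all `n`, given RH up to height `T`** (through
`isMultiplyPositiveSeq_xi_of_riemannHypothesisUpTo`). [cite: Katkova2006, Thm. 3] -/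
theorem katkova_exp_cosh_pf_of_riemannHypothesisUpTo {T : ℝ} {m : ℕ}
    (hRH : DiophantineGeometry.RiemannHypothesisUpTo T) (hmT : (m : ℝ) + 1 ≤ Real.pi * T) (n : ℕ) :
    IsMultiplyPositiveSeq m
        (conv (fun k => (n : ℝ) ^ k / (k ! : ℝ)) (fun k => xiTaylorCoeff k / (k ! : ℝ))) ∧
      IsMultiplyPositiveSeq m
        (conv (fun k => (n : ℝ) ^ (2 * k) / ((2 * k) ! : ℝ))
          (fun k => xiTaylorCoeff k / (k ! : ℝ))) :=
  katkova_exp_cosh_pf_of_isMultiplyPositiveSeq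
    (isMultiplyPositiveSeq_xi_of_riemannHypothesisUpTo hRH hmT) n

/-- **RH implies Theorem 3 for all `m` and all `n`** (`RH ⇒ ξ₁ ∈ PF_∞`,
`riemannHypothesis_iff_isPolyaFrequencySeq_xi`), in particular the named fact with `n₀ = 0`.
[cite: Katkova2006, Thm. 3] -/
theorem katkova_exp_cosh_pf_of_riemannHypothesis (hRH : RiemannHypothesis) : katkova_exp_cosh_pf :=
  fun m => ⟨0, fun n _ => katkova_exp_cosh_pf_of_isMultiplyPositiveSeq
    ((riemannHypothesis_iff_isPolyaFrequencySeq_xi.1 hRH).isMultiplyPositiveSeq m) n⟩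

/-- Projection (i) of the named fact. [cite: Katkova2006, Thm. 3 (i)] -/
theorem katkova_exp_cosh_pf.exp (h : katkova_exp_cosh_pf) (m : ℕ) :
    ∃ n₀ : ℕ, ∀ n : ℕ, n₀ ≤ n → IsMultiplyPositiveSeq m
      (conv (fun k => (n : ℝ) ^ k / (k ! : ℝ)) (fun k => xiTaylorCoeff k / (k ! : ℝ))) :=
  (h m).imp fun _ hn n hle => (hn n hle).1

/-- Projection (ii) of the named fact. [cite: Katkova2006, Thm. 3 (ii)] -/
theorem katkova_exp_cosh_pf.cosh (h : katkova_exp_cosh_pf) (m : ℕ) :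
    ∃ n₀ : ℕ, ∀ n : ℕ, n₀ ≤ n → IsMultiplyPositiveSeq m
      (conv (fun k => (n : ℝ) ^ (2 * k) / ((2 * k) ! : ℝ)) (fun k => xiTaylorCoeff k / (k ! : ℝ))) :=
  (h m).imp fun _ hn n hle => (hn n hle).2

/-! ### The dictionary: generating functions -/

/-- `Σ (c^k/k!) z^k = e^{cz}`. [folklore] -/
theorem hasSum_expSeq (c : ℝ) (z : ℂ) :
    HasSum (fun k => (((c ^ k / (k ! : ℝ) : ℝ)) : ℂ) * z ^ k) (Complex.exp ((c : ℂ) * z)) := by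
  have h := hasSum_exp_smul 1 c z
  simp only [one_mul, Complex.ofReal_one] at h
  exact h

/-- `Σ (c^{2k}/(2k)!) z^k = cosh(c w)` whenever `w² = z`. [folklore] -/
theorem hasSum_coshSeq (c : ℝ) {w z : ℂ} (hw : w ^ 2 = z) :
    HasSum (fun k => (((c ^ (2 * k) / ((2 * k) ! : ℝ) : ℝ)) : ℂ) * z ^ k)
      (Complex.cosh ((c : ℂ) * w)) := by
  have h := Complex.hasSum_cosh ((c : ℂ) * w)
  refine h.congr_fun fun k => ?_
  rw [mul_pow, pow_mul w 2 k, hw]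
  push_cast
  ring

/-- `Σ a_k z^k = 8 ξ₁(z)` for `a_k = γ(k)/k!` (`hasSum_xiSqCoeff_mul_pow` times `8`). [folklore] -/
theorem hasSum_xiSeq (z : ℂ) :
    HasSum (fun k => (((xiTaylorCoeff k / (k ! : ℝ) : ℝ)) : ℂ) * z ^ k) (8 * xiSq z) := by
  have h := (hasSum_xiSqCoeff_mul_pow z).mul_left 8
  refine h.congr_fun fun k => ?_
  have hk : (k ! : ℂ) ≠ 0 := by exact_mod_cast k.factorial_ne_zero
  rw [xiSqCoeff]
  push_cast
  field_simp

/-- Absolute convergence of an everywhere convergent power series with real coefficients.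
[folklore] -/
theorem summable_norm_of_hasSum_everywhere {x : ℕ → ℝ} {F : ℂ → ℂ}
    (h : ∀ z : ℂ, HasSum (fun k => (x k : ℂ) * z ^ k) (F z)) (z : ℂ) :
    Summable fun k => ‖(x k : ℂ) * z ^ k‖ :=
  summable_norm_of_hasSum (r := ‖z‖ + 1) (by positivity) (fun z' _ => h z') (lt_add_one _)

/-- **`Σ_k (e_c ⋆ a)_k z^k = e^{cz} · 8 ξ₁(z)`**: the convolution of `(c^k/k!)` with `(γ(k)/k!)`
is the coefficient sequence of `8 e^{cz} ξ₁(z)`. [Katkova2006, §2 (15)] [folklore] -/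
theorem hasSum_conv_exp_xi (c : ℝ) (z : ℂ) :
    HasSum (fun k => ((conv (fun k => c ^ k / (k ! : ℝ)) (fun k => xiTaylorCoeff k / (k ! : ℝ)) k
      : ℝ) : ℂ) * z ^ k) (Complex.exp ((c : ℂ) * z) * (8 * xiSq z)) :=
  hasSum_conv (hasSum_expSeq c z) (hasSum_xiSeq z)
    (summable_norm_of_hasSum_everywhere (hasSum_expSeq c) z)
    (summable_norm_of_hasSum_everywhere hasSum_xiSeq z)

/-- **`Σ_k (cosh_c ⋆ a)_k z^k = cosh(c w) · 8 ξ₁(z)` for `w² = z`**: the convolution of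
`(c^{2k}/(2k)!)` with `(γ(k)/k!)` is the coefficient sequence of `8 cosh(c√z) ξ₁(z)`.
[Katkova2006, §2 (15)] [folklore] -/
theorem hasSum_conv_cosh_xi (c : ℝ) {w z : ℂ} (hw : w ^ 2 = z) :
    HasSum (fun k => ((conv (fun k => c ^ (2 * k) / ((2 * k) ! : ℝ))
      (fun k => xiTaylorCoeff k / (k ! : ℝ)) k : ℝ) : ℂ) * z ^ k)
      (Complex.cosh ((c : ℂ) * w) * (8 * xiSq z)) := by
  have hsq : ∀ z : ℂ, (z ^ (2⁻¹ : ℂ)) ^ 2 = z := fun z => by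
    exact_mod_cast Complex.cpow_nat_inv_pow z two_ne_zero
  have hall : ∀ z : ℂ, HasSum (fun k => (((c ^ (2 * k) / ((2 * k) ! : ℝ) : ℝ)) : ℂ) * z ^ k)
      (Complex.cosh ((c : ℂ) * z ^ (2⁻¹ : ℂ))) := fun z => hasSum_coshSeq c (hsq z)
  exact hasSum_conv (hasSum_coshSeq c hw) (hasSum_xiSeq z)
    (summable_norm_of_hasSum_everywhere hall z) (summable_norm_of_hasSum_everywhere hasSum_xiSeq z)

/-- **Taylor coefficients of `e^{cz} ξ₁(z)`**: `(e^{cz} ξ₁)⁽ᵏ⁾(0)/k! = 8⁻¹ (e_c ⋆ a)_k` — so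
"`e^{nz} ξ₁ ∈ PF_m`" [Katkova2006, Def. 2] is literally `IsMultiplyPositiveSeq m` of the
sequence in `katkova_exp_cosh_pf` (i), up to the factor `8`. [folklore] -/
theorem taylorCoeff_exp_mul_xiSq (c : ℝ) (k : ℕ) :
    iteratedDeriv k (fun z => Complex.exp ((c : ℂ) * z) * xiSq z) 0 / k ! =
      ((8⁻¹ * conv (fun k => c ^ k / (k ! : ℝ)) (fun k => xiTaylorCoeff k / (k ! : ℝ)) k : ℝ) : ℂ) := by
  have h : ∀ z : ℂ, ‖z‖ < 1 → HasSum (fun k => (((8⁻¹ * conv (fun k => c ^ k / (k ! : ℝ))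
      (fun k => xiTaylorCoeff k / (k ! : ℝ)) k : ℝ) : ℂ)) * z ^ k)
      (Complex.exp ((c : ℂ) * z) * xiSq z) := fun z _ => by
    have h8 := (hasSum_conv_exp_xi c z).mul_left 8⁻¹
    rw [show (8⁻¹ : ℂ) * (Complex.exp ((c : ℂ) * z) * (8 * xiSq z)) =
      Complex.exp ((c : ℂ) * z) * xiSq z by ring] at h8
    refine h8.congr_fun fun k => ?_
    push_cast
    ring
  exact taylorCoeff_eq_of_hasSum one_pos h k

/-- **Taylor coefficients of `cosh(c√z) ξ₁(z)`**, i.e. of the entire function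
`z ↦ cosh(c z^{1/2}) ξ₁(z)` (`cosh` is even, so the branch of `z^{1/2}` is immaterial; the power
series below converges on all of `ℂ`): `(cosh(c√z) ξ₁)⁽ᵏ⁾(0)/k! = 8⁻¹ (cosh_c ⋆ a)_k` — so
"`cosh(n√z) ξ₁ ∈ PF_m`" is `IsMultiplyPositiveSeq m` of the sequence in `katkova_exp_cosh_pf` (ii),
up to the factor `8`. [folklore] -/
theorem taylorCoeff_cosh_mul_xiSq (c : ℝ) (k : ℕ) :
    iteratedDeriv k (fun z => Complex.cosh ((c : ℂ) * z ^ (2⁻¹ : ℂ)) * xiSq z) 0 / k ! =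
      ((8⁻¹ * conv (fun k => c ^ (2 * k) / ((2 * k) ! : ℝ))
        (fun k => xiTaylorCoeff k / (k ! : ℝ)) k : ℝ) : ℂ) := by
  have hsq : ∀ z : ℂ, (z ^ (2⁻¹ : ℂ)) ^ 2 = z := fun z => by
    exact_mod_cast Complex.cpow_nat_inv_pow z two_ne_zero
  have h : ∀ z : ℂ, ‖z‖ < 1 → HasSum (fun k => (((8⁻¹ * conv (fun k => c ^ (2 * k) / ((2 * k) ! : ℝ))
      (fun k => xiTaylorCoeff k / (k ! : ℝ)) k : ℝ) : ℂ)) * z ^ k)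
      (Complex.cosh ((c : ℂ) * z ^ (2⁻¹ : ℂ)) * xiSq z) := fun z _ => by
    have h8 := (hasSum_conv_cosh_xi c (hsq z)).mul_left 8⁻¹
    rw [show (8⁻¹ : ℂ) * (Complex.cosh ((c : ℂ) * z ^ (2⁻¹ : ℂ)) * (8 * xiSq z)) =
      Complex.cosh ((c : ℂ) * z ^ (2⁻¹ : ℂ)) * xiSq z by ring] at h8
    refine h8.congr_fun fun k => ?_
    push_cast
    ring
  exact taylorCoeff_eq_of_hasSum one_pos h k

/-! ### Katkova's RH-equivalences after Theorem 3 — proved -/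

/-- **`e^{cz} ξ₁ ∈ PF_∞ ⇒ RH`** ("multiplication by the function `e^{nz}` does not change zero set
of `ξ₁(z)`" [Katkova2006, remark after Thm. 3]): normalise the PF sequence `e_c ⋆ a` to start with
`1` (`(e_c ⋆ a)₀ = γ(0) > 0`); its generating function `8γ(0)⁻¹ e^{cz} ξ₁(z)` is entire, so by the
Aissen–Schoenberg–Whitney zero theorem (`IsPolyaFrequencySeq.zero_of_entire`) all its zeros — in
particular all zeros of `ξ₁` — are real and negative, which is RH
(`xiSq_zeros_iff_riemannHypothesis`). [cite: Katkova2006, Thm. 3 (remark following)] -/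
theorem riemannHypothesis_of_isPolyaFrequencySeq_conv_exp_xi {c : ℝ}
    (h : IsPolyaFrequencySeq
      (conv (fun k => c ^ k / (k ! : ℝ)) (fun k => xiTaylorCoeff k / (k ! : ℝ)))) :
    RiemannHypothesis := by
  set p : ℕ → ℝ := conv (fun k => c ^ k / (k ! : ℝ)) (fun k => xiTaylorCoeff k / (k ! : ℝ))
    with hp
  have hγ0 : 0 < xiTaylorCoeff 0 := xiTaylorCoeff_zero_pos
  have hp0 : p 0 = xiTaylorCoeff 0 := by rw [hp, conv_apply_zero]; simp
  set q : ℕ → ℝ := fun k => (xiTaylorCoeff 0)⁻¹ * p k with hq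
  have hqPF : IsPolyaFrequencySeq q := h.smul (inv_nonneg.2 hγ0.le)
  have hq0 : q 0 = 1 := by rw [hq]; simp only [hp0]; exact inv_mul_cancel₀ hγ0.ne'
  have hsum : ∀ z : ℂ, HasSum (fun k => (q k : ℂ) * z ^ k)
      (((xiTaylorCoeff 0 : ℝ) : ℂ)⁻¹ * (Complex.exp ((c : ℂ) * z) * (8 * xiSq z))) := fun z => by
    have h1 := (hasSum_conv_exp_xi c z).mul_left (((xiTaylorCoeff 0 : ℝ) : ℂ)⁻¹)
    refine h1.congr_fun fun k => ?_
    simp only [hq]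
    push_cast
    ring
  have hS : ∀ z : ℂ, Summable fun k => ‖(q k : ℂ) * z ^ k‖ :=
    summable_norm_of_hasSum_everywhere hsum
  refine xiSq_zeros_iff_riemannHypothesis.1 fun w hw => ?_
  have hz : ∑' k, (q k : ℂ) * w ^ k = 0 := by rw [(hsum w).tsum_eq, hw]; simp
  obtain ⟨him, hre⟩ := hqPF.zero_of_entire hq0 hS hz
  exact ⟨him, hre.le⟩

/-- **`cosh(c√z) ξ₁ ∈ PF_∞ ⇒ RH`** ("multiplication by the function `cosh(n√z)` adds only
negative zeros" [Katkova2006, remark after Thm. 3]): as for `e^{cz}`, with the entire generating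
function `8γ(0)⁻¹ cosh(c z^{1/2}) ξ₁(z)`, whose zero set contains that of `ξ₁`.
[cite: Katkova2006, Thm. 3 (remark following)] -/
theorem riemannHypothesis_of_isPolyaFrequencySeq_conv_cosh_xi {c : ℝ}
    (h : IsPolyaFrequencySeq
      (conv (fun k => c ^ (2 * k) / ((2 * k) ! : ℝ)) (fun k => xiTaylorCoeff k / (k ! : ℝ)))) :
    RiemannHypothesis := by
  set p : ℕ → ℝ := conv (fun k => c ^ (2 * k) / ((2 * k) ! : ℝ))
    (fun k => xiTaylorCoeff k / (k ! : ℝ)) with hp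
  have hγ0 : 0 < xiTaylorCoeff 0 := xiTaylorCoeff_zero_pos
  have hp0 : p 0 = xiTaylorCoeff 0 := by rw [hp, conv_apply_zero]; simp
  set q : ℕ → ℝ := fun k => (xiTaylorCoeff 0)⁻¹ * p k with hq
  have hqPF : IsPolyaFrequencySeq q := h.smul (inv_nonneg.2 hγ0.le)
  have hq0 : q 0 = 1 := by rw [hq]; simp only [hp0]; exact inv_mul_cancel₀ hγ0.ne'
  have hsq : ∀ z : ℂ, (z ^ (2⁻¹ : ℂ)) ^ 2 = z := fun z => by
    exact_mod_cast Complex.cpow_nat_inv_pow z two_ne_zero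
  have hsum : ∀ z : ℂ, HasSum (fun k => (q k : ℂ) * z ^ k)
      (((xiTaylorCoeff 0 : ℝ) : ℂ)⁻¹ *
        (Complex.cosh ((c : ℂ) * z ^ (2⁻¹ : ℂ)) * (8 * xiSq z))) := fun z => by
    have h1 := (hasSum_conv_cosh_xi c (hsq z)).mul_left (((xiTaylorCoeff 0 : ℝ) : ℂ)⁻¹)
    refine h1.congr_fun fun k => ?_
    simp only [hq]
    push_cast
    ring
  have hS : ∀ z : ℂ, Summable fun k => ‖(q k : ℂ) * z ^ k‖ :=
    summable_norm_of_hasSum_everywhere hsum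
  refine xiSq_zeros_iff_riemannHypothesis.1 fun w hw => ?_
  have hz : ∑' k, (q k : ℂ) * w ^ k = 0 := by rw [(hsum w).tsum_eq, hw]; simp
  obtain ⟨him, hre⟩ := hqPF.zero_of_entire hq0 hS hz
  exact ⟨him, hre.le⟩

/-- **`e^{cz} ξ₁ ∈ PF_∞ ↔ RH`** for every real `c ≥ 0` (in the normalisation `a_k = γ(k)/k!`):
`⇐` is `RH ⇒ ξ₁ ∈ PF_∞` (`riemannHypothesis_iff_isPolyaFrequencySeq_xi`) and closure of PF under
convolution with `(c^k/k!)`. [cite: Katkova2006, Thm. 3 (remark following)] -/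
theorem isPolyaFrequencySeq_conv_exp_xi_iff {c : ℝ} (hc : 0 ≤ c) :
    IsPolyaFrequencySeq
        (conv (fun k => c ^ k / (k ! : ℝ)) (fun k => xiTaylorCoeff k / (k ! : ℝ))) ↔
      RiemannHypothesis :=
  ⟨riemannHypothesis_of_isPolyaFrequencySeq_conv_exp_xi, fun hRH =>
    (isPolyaFrequencySeq_exp hc).conv (riemannHypothesis_iff_isPolyaFrequencySeq_xi.1 hRH)⟩

/-- **`cosh(c√z) ξ₁ ∈ PF_∞ ↔ RH`** for every real `c ≥ 0`.
[cite: Katkova2006, Thm. 3 (remark following)] -/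
theorem isPolyaFrequencySeq_conv_cosh_xi_iff {c : ℝ} (hc : 0 ≤ c) :
    IsPolyaFrequencySeq
        (conv (fun k => c ^ (2 * k) / ((2 * k) ! : ℝ)) (fun k => xiTaylorCoeff k / (k ! : ℝ))) ↔
      RiemannHypothesis :=
  ⟨riemannHypothesis_of_isPolyaFrequencySeq_conv_cosh_xi, fun hRH =>
    (isPolyaFrequencySeq_cosh_sqrt hc).conv (riemannHypothesis_iff_isPolyaFrequencySeq_xi.1 hRH)⟩

/-- **Katkova's first displayed equivalence** [Katkova2006, arXiv p. 6]: "the Riemann Hypothesis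
is equivalent to … `∃ n ∈ ℕ ∀ m ∈ ℕ : e^{nz} ξ₁(z) ∈ PF_m`" (`PF_∞ = ∩ₘ PF_m`,
`isPolyaFrequencySeq_iff_forall`; the witness produced from RH is `n = 1`).
[cite: Katkova2006, Thm. 3 (remark following)] -/
theorem riemannHypothesis_iff_exists_forall_pf_exp_mul :
    RiemannHypothesis ↔ ∃ n : ℕ, ∀ m : ℕ, IsMultiplyPositiveSeq m
      (conv (fun k => (n : ℝ) ^ k / (k ! : ℝ)) (fun k => xiTaylorCoeff k / (k ! : ℝ))) := by
  constructor
  · intro hRH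
    exact ⟨1, isPolyaFrequencySeq_iff_forall.1
      ((isPolyaFrequencySeq_conv_exp_xi_iff (Nat.cast_nonneg 1)).2 hRH)⟩
  · rintro ⟨n, hn⟩
    exact riemannHypothesis_of_isPolyaFrequencySeq_conv_exp_xi (isPolyaFrequencySeq_iff_forall.2 hn)

/-- **Katkova's second displayed equivalence** [Katkova2006, arXiv p. 7]: "… or
`∃ n ∈ ℕ ∀ m ∈ ℕ : cosh(n√z) ξ₁(z) ∈ PF_m`". [cite: Katkova2006, Thm. 3 (remark following)] -/
theorem riemannHypothesis_iff_exists_forall_pf_cosh_mul :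
    RiemannHypothesis ↔ ∃ n : ℕ, ∀ m : ℕ, IsMultiplyPositiveSeq m
      (conv (fun k => (n : ℝ) ^ (2 * k) / ((2 * k) ! : ℝ))
        (fun k => xiTaylorCoeff k / (k ! : ℝ))) := by
  constructor
  · intro hRH
    exact ⟨1, isPolyaFrequencySeq_iff_forall.1
      ((isPolyaFrequencySeq_conv_cosh_xi_iff (Nat.cast_nonneg 1)).2 hRH)⟩
  · rintro ⟨n, hn⟩
    exact riemannHypothesis_of_isPolyaFrequencySeq_conv_cosh_xi (isPolyaFrequencySeq_iff_forall.2 hn)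

end Literature.NumberTheory.LFunctions

end
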